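import Summits.CriticalPhenomena.Ising3D.TaylorRegionLitRows
import Mathlib.Tactic.Linarith
import Mathlib.Tactic.Positivity
import Mathlib.Tactic.Ring
import HarnessLib

/-!
# Per-PIECE declarations: the even region from a prefix Boolean and a family of small piece Booleans
(cell `pub-ising3x`, seat recog-1 gen 11; gate (g2) — the certificate FORMAT consequence of the measured per-declaration
kernel cutoff)

HONEST FRAMING: lottery ticket; floor = tightest certified 3D Ising CFT bounds; no exact-solution
claim without a proof. Island framing: certified exclusion region at stated derivative order and
assumptions; not a determination of the 3D Ising critical exponents beyond that.

MEASURED: one `decide +kernel` declaration that needs more than ≈ 170–190 s of kernel work on the farm ends 'did not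
reduce' (a cutoff, not a verdict), while a real `Λ = 11` box needs hours in total. So a certificate cannot be ONE
Boolean; it is a PREFIX Boolean (`EvenRegionDataH.prefixOKL`: sizes, tails, containment of every computed row in its
producer literal — one declaration) plus, for every integer `j ≤ J₁` and every one of `K` uniform pieces of
`[max(E₀, j) − cc, E₁ − cc]`, a small PIECE Boolean on the literal rows (`pieceOK`: `X, Y` by `posOn`, discriminant by
`posOnD`) — each its own declaration, each seconds. **`taylorEvenRegion_of_pieces`** assembles them:
`prefixOKL = true → (∀ j k, j < J₁+1 → k < K → pieceOK … j k = true) → TaylorEvenRegion …`; turnkey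
`taylorEvenRegion_of_certPieces` and the capstone **`TaylorTable.boxExcluded_of_taylorTable_dec_of_pieces`**. The
`∀ j k` hypothesis is discharged in a certificate file by `interval_cases` over the per-piece theorems. Elementary. [folklore]
-/

namespace Summit.CriticalPhenomena.Ising3D

open Finset Set
open Literature.Analysis.ValidatedNumerics Literature.Analysis.ValidatedNumerics.PolyMP
open Literature.Analysis.ValidatedNumerics.NumericsMP (MI)
open Literature.MathematicalPhysics.QuantumFieldTheory.ConformalBootstrap3D

namespace EvenRegionDataH

/-- Left end of the `k`-th of `K` uniform pieces of row `j`'s interval `[max(E₀,j) − cc, E₁ − cc]`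
(`k = K` gives the right end of the last piece). [folklore] -/
def pieceLo (d : EvenRegionDataH) (K j k : ℕ) : ℚ :=
  (max d.E0 (j : ℚ) - d.ccQ) + (k : ℚ) * ((d.E1 - max d.E0 (j : ℚ)) / (K : ℚ))

/-- ONE piece of row `j` on the producer literals `L[j] = (LX, LY, LZ)`: `X, Y` positive by `posOn`, discriminant by
`posOnD`, each to depth `dPj` inside the piece; vacuously true when the row's interval is empty. [folklore] -/
def pieceOK (d : EvenRegionDataH) (L : List (IPoly × IPoly × IPoly)) (K j k : ℕ) : Bool :=
  decide (d.E1 < max d.E0 (j : ℚ)) ||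
  (posOn d.S d.dPj (L.getD j ([], [], [])).1 (d.pieceLo K j k) (d.pieceLo K j (k + 1)) &&
    posOn d.S d.dPj (L.getD j ([], [], [])).2.1 (d.pieceLo K j k) (d.pieceLo K j (k + 1)) &&
    posOnD d.S (L.getD j ([], [], [])).1 (L.getD j ([], [], [])).2.1 (L.getD j ([], [], [])).2.2 d.dPj
      (d.pieceLo K j k) (d.pieceLo K j (k + 1)))

/-- The prefix: everything of `checkPDL` except the pieces (sizes, `(E, θ)` tails, containment of the computed rows in
the literals). [folklore] -/
def prefixOKL (d : EvenRegionDataH) (L : List (IPoly × IPoly × IPoly)) : Bool :=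
  decide (0 < d.S) && decide (0 < d.E0) && decide (d.E1 ≤ (d.J1 : ℚ) + 1) && momLenOK d.N d.R &&
  kernelSizeOK d.S (d.cQ 0) (-1) d.sσI d.ccQ d.l d.N && kernelSizeOK d.S (d.cQ 1) (-1) d.sεI d.ccQ d.l d.N &&
  kernelSizeOK d.S (d.cQ 3) (-1) d.sbI d.ccQ d.l d.N && kernelSizeOK d.S (d.cQ 4) 1 d.sbI d.ccQ d.l d.N &&
  decide (1 ≤ d.prmX.θhi) && decide (1 ≤ d.prmY.θhi) && decide (1 ≤ d.prmD.θhi) &&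
  halfStripPos2 d.S d.TX (d.E1 - d.ccQ) d.prmX && halfStripPos2 d.S d.TY (d.E1 - d.ccQ) d.prmY &&
  halfStripPosD d.S d.TX d.TY d.TZ (d.E1 - d.ccQ) d.prmD &&
  (List.range (d.J1 + 1)).all fun j =>
    subsetI (d.PX j) (L.getD j ([], [], [])).1 && subsetI (d.PY j) (L.getD j ([], [], [])).2.1 &&
      subsetI (d.PZ j) (L.getD j ([], [], [])).2.2

end EvenRegionDataH

/-- **The even region from the prefix and the pieces** (statement of `taylorEvenRegion_of_evenRegionCheckH`). [folklore] -/
theorem taylorEvenRegion_of_pieces (d : EvenRegionDataH) (L : List (IPoly × IPoly × IPoly)) {K : ℕ} (hK : 0 < K)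
    (hl : d.l.Nodup) (Q : Set (ℝ × ℝ))
    (hQ : ∀ p ∈ Q, MI.mem d.S p.1 d.sσI ∧ MI.mem d.S p.2 d.sεI ∧ MI.mem d.S ((p.1 + p.2) / 2) d.sbI)
    (hpre : d.prefixOKL L = true) (hpc : ∀ j k : ℕ, j < d.J1 + 1 → k < K → d.pieceOK L K j k = true) :
    TaylorEvenRegion (taylorCrossing (1 / 2) (1 / 2) d.l.toFinset fun i ab => (d.cQ i ab : ℝ)) Q ((d.E0 : ℚ) : ℝ) := by
  simp only [EvenRegionDataH.prefixOKL, Bool.and_eq_true, decide_eq_true_eq] at hpre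
  obtain ⟨⟨⟨⟨⟨⟨⟨⟨⟨⟨⟨⟨⟨⟨hS, hE0⟩, hJ1⟩, hR⟩, hN0⟩, hN1⟩, hN3⟩, hN4⟩, hθX⟩, hθY⟩, hθD⟩, hX⟩, hY⟩, hD⟩, hrows⟩ := hpre
  refine taylorEvenRegion_half_of_qRegion _ _ Q _ fun p hp E j hE hj => ?_
  obtain ⟨hsσ, hsε, hsb⟩ := hQ p hp
  have hEpos : 0 < E := lt_of_lt_of_le (by exact_mod_cast hE0) hE
  by_cases hE1 : ((d.E1 : ℚ) : ℝ) ≤ E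
  · have hθ := div_mem_unit hEpos hj
    have hP : ((d.E1 - d.ccQ : ℚ) : ℝ) ≤ E - d.ccQ := by push_cast; linarith
    have eX := qSum_eq_eval2_momTable hS (d.cQ 0) (-1) hsσ d.ccQ hl hN0 hR hEpos j
    have eY := qSum_eq_eval2_momTable hS (d.cQ 1) (-1) hsε d.ccQ hl hN1 hR hEpos j
    have eZ3 := qSum_eq_eval2_momTable hS (d.cQ 3) (-1) hsb d.ccQ hl hN3 hR hEpos j
    have eZ4 := qSum_eq_eval2_momTable hS (d.cQ 4) 1 hsb d.ccQ hl hN4 hR hEpos j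
    have pX := pmem2_momTableI hS (d.cQ 0) (-1) hsσ d.ccQ d.l d.N d.R
    have pY := pmem2_momTableI hS (d.cQ 1) (-1) hsε d.ccQ d.l d.N d.R
    have pZ := pmem2_add2I (pmem2_momTableI hS (d.cQ 3) (-1) hsb d.ccQ d.l d.N d.R)
      (pmem2_momTableI hS (d.cQ 4) 1 hsb d.ccQ d.l d.N d.R)
    have vX := halfStripPos2_sound hS pX hX hP hθ.1 (hθ.2.trans (by exact_mod_cast hθX))
    have vY := halfStripPos2_sound hS pY hY hP hθ.1 (hθ.2.trans (by exact_mod_cast hθY))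
    have vD := halfStripPosD_sound hS pX pY pZ hD hP hθ.1 (hθ.2.trans (by exact_mod_cast hθD))
    rw [eval2_add2] at vD
    simp only [Rat.cast_neg, Rat.cast_one] at eX eY eZ3 eZ4
    have goalD : (qSum (fun ab => (d.cQ 3 ab : ℝ)) d.l.toFinset ((p.1 + p.2) / 2) (-1) E j +
        qSum (fun ab => (d.cQ 4 ab : ℝ)) d.l.toFinset ((p.1 + p.2) / 2) 1 E j) ^ 2 ≤
        4 * qSum (fun ab => (d.cQ 0 ab : ℝ)) d.l.toFinset p.1 (-1) E j *
          qSum (fun ab => (d.cQ 1 ab : ℝ)) d.l.toFinset p.2 (-1) E j := by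
      rw [eX, eY, eZ3, eZ4, sq]; linarith
    exact ⟨by rw [eX]; exact vX.le, by rw [eY]; exact vY.le, goalD⟩
  · have hElt : E < d.E1 := lt_of_not_ge hE1
    have hjJ : j < d.J1 + 1 := by
      have h1 : (j : ℝ) < (d.J1 : ℝ) + 1 := by
        have : ((d.E1 : ℚ) : ℝ) ≤ (d.J1 : ℝ) + 1 := by exact_mod_cast hJ1
        linarith
      exact_mod_cast h1
    have hrow := List.all_eq_true.mp hrows j (List.mem_range.mpr hjJ)
    simp only [Bool.and_eq_true] at hrow
    obtain ⟨⟨sX, sY⟩, sZ⟩ := hrow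
    have pX := pmem_of_subsetI
      (pmem_qRowOfTableI (pmem2_kernelPDLI_of_mem hS hsσ (d.cQ 0) (-1) d.ccQ d.l) d.N j) sX
    have pY := pmem_of_subsetI
      (pmem_qRowOfTableI (pmem2_kernelPDLI_of_mem hS hsε (d.cQ 1) (-1) d.ccQ d.l) d.N j) sY
    have pZ := pmem_of_subsetI
      (pmem_addI (pmem_qRowOfTableI (pmem2_kernelPDLI_of_mem hS hsb (d.cQ 3) (-1) d.ccQ d.l) d.N j)
        (pmem_qRowOfTableI (pmem2_kernelPDLI_of_mem hS hsb (d.cQ 4) 1 d.ccQ d.l) d.N j)) sZ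
    -- locate the piece of P = E − cc
    have hmE : ((max d.E0 (j : ℚ) : ℚ) : ℝ) ≤ E := by push_cast; exact max_le hE hj
    have hmE2 : max (d.E0 : ℝ) (j : ℝ) ≤ E := max_le hE hj
    have hm1 : max d.E0 (j : ℚ) ≤ d.E1 := by
      have : ((max d.E0 (j : ℚ) : ℚ) : ℝ) ≤ ((d.E1 : ℚ) : ℝ) := hmE.trans hElt.le
      exact_mod_cast this
    have hKq : (K : ℚ) ≠ 0 := by exact_mod_cast hK.ne'
    have hw : 0 ≤ (d.E1 - max d.E0 (j : ℚ)) / (K : ℚ) := div_nonneg (by linarith) (by positivity)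
    have hmono : ∀ k : ℕ, d.pieceLo K j k ≤ d.pieceLo K j (k + 1) := fun k => by
      unfold EvenRegionDataH.pieceLo; push_cast; nlinarith
    have e0 : d.pieceLo K j 0 = max d.E0 (j : ℚ) - d.ccQ := by unfold EvenRegionDataH.pieceLo; simp
    have eK : d.pieceLo K j K = d.E1 - d.ccQ := by
      unfold EvenRegionDataH.pieceLo; field_simp; ring
    have hn1 : K - 1 + 1 = K := Nat.sub_add_cancel hK
    obtain ⟨k, hk, hk1, hk2⟩ := exists_mem_gridCell (fun k : ℕ => ((d.pieceLo K j k : ℚ) : ℝ)) (K - 1)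
      (Δ := E - d.ccQ) (by show ((d.pieceLo K j 0 : ℚ) : ℝ) ≤ E - d.ccQ; rw [e0]; push_cast; linarith [hmE2])
      (by show E - d.ccQ ≤ ((d.pieceLo K j (K - 1 + 1) : ℚ) : ℝ); rw [hn1, eK]; push_cast; linarith)
    have hkK : k < K := by omega
    have hpiece := hpc j k hjJ hkK
    simp only [EvenRegionDataH.pieceOK, Bool.or_eq_true, Bool.and_eq_true, decide_eq_true_eq] at hpiece
    rcases hpiece with hvac | ⟨⟨rX, rY⟩, rD⟩
    · exfalso
      have : ((d.E1 : ℚ) : ℝ) < ((max d.E0 (j : ℚ) : ℚ) : ℝ) := by exact_mod_cast hvac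
      linarith
    have vX := posOn_sound hS rX (hmono k) pX hk1 hk2
    have vY := posOn_sound hS rY (hmono k) pY hk1 hk2
    have vD := posOnD_sound hS pX pY pZ rD (hmono k) hk1 hk2
    rw [evalR_addR] at vD
    have eX := qSum_eq_evalR_qRowOfTable hS (d.cQ 0) (-1) hsσ d.ccQ hl hN0 E j
    have eY := qSum_eq_evalR_qRowOfTable hS (d.cQ 1) (-1) hsε d.ccQ hl hN1 E j
    have eZ3 := qSum_eq_evalR_qRowOfTable hS (d.cQ 3) (-1) hsb d.ccQ hl hN3 E j
    have eZ4 := qSum_eq_evalR_qRowOfTable hS (d.cQ 4) 1 hsb d.ccQ hl hN4 E j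
    simp only [Rat.cast_neg, Rat.cast_one] at eX eY eZ3 eZ4 vX vY vD
    have goalD : (qSum (fun ab => (d.cQ 3 ab : ℝ)) d.l.toFinset ((p.1 + p.2) / 2) (-1) E j +
        qSum (fun ab => (d.cQ 4 ab : ℝ)) d.l.toFinset ((p.1 + p.2) / 2) 1 E j) ^ 2 ≤
        4 * qSum (fun ab => (d.cQ 0 ab : ℝ)) d.l.toFinset p.1 (-1) E j *
          qSum (fun ab => (d.cQ 1 ab : ℝ)) d.l.toFinset p.2 (-1) E j := by
      rw [eX, eY, eZ3, eZ4, sq]; linarith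
    exact ⟨by rw [eX]; exact vX.le, by rw [eY]; exact vY.le, goalD⟩

/-! ### Turnkey and capstone -/

/-- [folklore] -/
theorem taylorEvenRegion_of_certPieces (c : EvenRegionCertH) (L : List (IPoly × IPoly × IPoly)) {K : ℕ} (hK : 0 < K)
    (hl : c.l.Nodup) (hpre : c.data.prefixOKL L = true)
    (hp : ∀ j k : ℕ, j < c.data.J1 + 1 → k < K → c.data.pieceOK L K j k = true) :
    TaylorEvenRegion (taylorCrossing (1 / 2) (1 / 2) c.l.toFinset fun i ab => (c.cQ i ab : ℝ))
      (Icc (c.box.σlo : ℝ) c.box.σhi ×ˢ Icc (c.box.εlo : ℝ) c.box.εhi) ((c.E0 : ℚ) : ℝ) := by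
  refine taylorEvenRegion_of_pieces c.data L hK hl _ (fun p hp => ?_) hpre hp
  obtain ⟨h1, h2, h3, h4⟩ := BoxQ.bounds (B := c.box) hp
  refine ⟨mem_enclQ _ h1 h2, mem_enclQ _ h3 h4, mem_enclQ _ ?_ ?_⟩
  · push_cast; linarith
  · push_cast; linarith

namespace TaylorTable

variable (T : TaylorTable)

/-- **Capstone with per-piece hypotheses**: table check, enclosure check, even prefix + pieces, odd certificate. [folklore] -/
theorem boxExcluded_of_taylorTable_dec_of_pieces (h : T.check = true) (he : T.checkEncl = true)
    (πE : EvenRegionParamsH) (L : List (IPoly × IPoly × IPoly)) {K : ℕ} (hK : 0 < K)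
    (hl : (T.evenCertH πE).l.Nodup) (hpre : (T.evenCertH πE).data.prefixOKL L = true)
    (hp : ∀ j k : ℕ, j < (T.evenCertH πE).data.J1 + 1 → k < K → (T.evenCertH πE).data.pieceOK L K j k = true)
    (πO : OddConeParamsH) (hO : (T.oddCertH πO).checkP = true) : BoxExcluded T.box :=
  T.boxExcluded_of_taylorTable_dec h he (taylorEvenRegion_of_certPieces (T.evenCertH πE) L hK hl hpre hp)
    (T.oddCone_of_oddCertHP πO hO)

end TaylorTable

/-! ### Fixture: the toy through prefix + pieces (`K = 2`), pieces discharged one by one -/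

/-- [folklore] -/
theorem toyEven_prefixOKL : toyEvenRegionCertH.data.prefixOKL toyEvenLits = true := by
  decide +kernel

/-- [folklore] -/
theorem toyEven_pieces : ∀ j k : ℕ, j < toyEvenRegionCertH.data.J1 + 1 → k < 2 →
    toyEvenRegionCertH.data.pieceOK toyEvenLits 2 j k = true := by
  have hJ : toyEvenRegionCertH.data.J1 + 1 = 9 := by decide
  intro j k hj hk
  rw [hJ] at hj
  interval_cases j <;> interval_cases k <;> decide +kernel

/-- [folklore] -/
theorem toyEven_region_of_pieces :
    TaylorEvenRegion (taylorCrossing (1 / 2) (1 / 2) toyEvenRegionCertH.l.toFinset fun i ab => (toyEvenRegionCertH.cQ i ab : ℝ))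
      (Icc (toyEvenRegionCertH.box.σlo : ℝ) toyEvenRegionCertH.box.σhi ×ˢ
        Icc (toyEvenRegionCertH.box.εlo : ℝ) toyEvenRegionCertH.box.εhi) ((toyEvenRegionCertH.E0 : ℚ) : ℝ) :=
  taylorEvenRegion_of_certPieces toyEvenRegionCertH toyEvenLits (K := 2) (by norm_num) (by decide)
    toyEven_prefixOKL toyEven_pieces

end Summit.CriticalPhenomena.Ising3D
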